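/-
Copyright: the b2b-balaban T⁴-continuum CRUX team, row NE7b leaf lineage `t4-ne7b-formalise-leaf-03` (gen 147). Project licence.
-/
import Mathlib.Analysis.Normed.Operator.Basic
import Mathlib.Analysis.Normed.Module.Basic
import Mathlib.Analysis.SpecialFunctions.Pow.Real
import Mathlib.Tactic.Positivity
import Mathlib.Tactic.FieldSimp
import Mathlib.Tactic.Linarith

/-!
# THE HARD STEP'S BACKGROUND FIELD — AND ITS MULTIPLIER — ARE LIPSCHITZ IN THE KEPT VARIABLE FROM THE SOCKETS' TWO
# FIRST-ORDER LETTERS ALONE, ON A WINDOW: if `a` minimises `V` on the fibre `{D· = w}` and `b` on `{D· = w′}`, and `V`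
# carries at `a` and at `b` — on a window `K` — the strong first-order letter (modulus `m`) and the growth letter
# (constant `L`) with differentials `A`, `B` killing `ker D`, then for ANY right inverse `M` of `D`, with `h = w′ − w`:
# `m(‖a + Mh − b‖² + ‖b − a‖²) ≤ L‖Mh‖²`, so `‖b − a‖ ≤ √(L∕m)·‖M‖·‖w′ − w‖` (test points `a`, `b − Mh ∈ K` only), and
# `‖A − B‖ ≤ L‖a − b‖ ≤ L√(L∕m)·‖Mh‖` — no second derivative, no dimension, no implicit function (row NE7b, node U5c; the
# `a = ∞` twin of leaf-04's `SoftStepBackgroundLipschitz` «y₀(x) Lipschitz 2aκ∕σ from σ alone»; TRANSFER row (ix), idea-1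
# T-93, N-93-1 «print confines uniqueness to the small-field space»; [folklore])

Cell `pub-balaban`, sub-cell `t4`, spine estimate NE7b (`T4WeightBudget.RelWeightBound`; NOT PRINTED in [Bałaban 1983–89],
NOT PROVED).  Crux-route work under `Spine/NE7b/` by leaf-03 (CRUX team (2), FREEZE (0) crux-prover clause).  NOTHING of
Bałaban's is named, asserted, valued or discharged.  Mathlib only; no `def`; zero `sorry`.

WHY.  `ConstrainedMinimiserRegular` (CMR, p379513) makes the hard-step minimiser `w ↦ δ(w)` a `Cⁿ` map — in finite dimension,
for `V ∈ C^{n+1}` with a non-degenerate Hessian.  The road's letters, however, are first-order and live on a WINDOW: at each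
scale the action is known through the sockets' pair (strong letter `m`, growth letter `L`; this lineage's CVD ∕ CVS ∕ CVG ∕ CVW,
the OWNER's (30)–(34)) on the small-field domain.  In THAT currency the background field is already LIPSCHITZ in the kept
variable, with constant `√(L∕m)·‖M‖`, by a THREE-LETTER CHAIN: the lower letter at `b` tested at `a`, the lower letter at
`a` tested at the competitor `b − Mh` (which lies on `a`'s fibre), the growth letter at `b` tested at `−Mh`; the linear terms
cancel because `A` and `B` kill the defect `a + Mh − b ∈ ker D`.  The differentials follow: the growth letters at both points
and convexity at one give the two-point estimate `t·(A − B)v ≤ (L∕2)(‖a − b‖² + t²‖v‖²)`, whence `‖A − B‖ ≤ L‖a − b‖` as soon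
as the window holds the ball of radius `‖a − b‖` about `a` — the MULTIPLIER of the hard step (`A = λ(w) ∘ D`) is Lipschitz in
the kept variable too.  leaf-04's SBL is the soft-step statement (`2aκ∕σ`); this is the `a = ∞` end, uniform in nothing but
`(m, L, ‖M‖)`, window-native.

WHAT IS PROVED ([folklore]; e.g. Bonnans–Shapiro (2000) Prop. 4.32 ∕ Dontchev–Rockafellar, *Implicit Functions and Solution
Mappings* §2G for the `C^{1,1}` statements — here from pointwise letters at the two minimisers only).  `E`, `F` real normed
spaces, `K : Set E` (NO convexity asked), `V : E → ℝ`, `D : E →L[ℝ] F`, `M : F →L[ℝ] E` with `D (M w) = w`; at `a` the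
letters ON `K` with differential `A`: LOWER `∀ x ∈ K, V a + A (x − a) + (m∕2)‖x − a‖² ≤ V x`, GROWTH
`∀ v, a + v ∈ K → V (a + v) ≤ V a + A v + (L∕2)‖v‖²`, `A` kills `ker D`; the same at `b` with `B`.  `h := D b − D a`.
* §1 **`sq_defect_add_sq_sub_le`** — THE THREE-LETTER CHAIN: `m(‖a + Mh − b‖² + ‖a − b‖²) ≤ L‖Mh‖²` (lower at `a` and `b`,
  growth at `b`, kernels; test points `a ∈ K`, `b − Mh ∈ K`).
* §2 **`norm_sub_le_of_letters`** — `‖b − a‖ ≤ √(L∕m)·‖Mh‖` (`0 < m`); `norm_defect_le` — `‖a + Mh − b‖ ≤ √(L∕m)·‖Mh‖`;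
  `norm_sub_le_opNorm_of_letters` — `‖b − a‖ ≤ √(L∕m)·‖M‖·‖D b − D a‖`; `norm_sub_le_of_letters_closedBall` — on
  `K = closedBall c R` the two memberships read `‖a − c‖ ≤ R`, `‖b − c‖ + ‖Mh‖ ≤ R` (a SMALL-STEP condition).
* §3 the differentials: `sub_apply_le_of_letters` — `(A − B)v ≤ (L∕2)(‖a − b‖² + ‖v‖²)` (growth at `a`, `b`; lower at `b`
  with the `m ≥ 0` term dropped; test points `a`, `a − v ∈ K`); `mul_sub_apply_le_of_letters` (at `t • v`);
  **`abs_sub_apply_le_of_letters_ball`** — `|(A − B)v| ≤ Lρ‖v‖` once `closedBall a ρ ⊆ K`, `‖a − b‖ ≤ ρ`, `0 < ρ`;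
  `opNorm_sub_le_of_letters_ball` — `‖A − B‖ ≤ Lρ`; `opNorm_sub_le_of_letters` — global letters: `‖A − B‖ ≤ L‖a − b‖`;
  **`opNorm_sub_le_of_rightInverse`** — global letters: `‖A − B‖ ≤ L·√(L∕m)·‖M (D b − D a)‖` (THE MULTIPLIER IS LIPSCHITZ
  IN THE KEPT VARIABLE).
* §4 toy (`example`): `E = F = ℝ`, `K = univ`, `D = M = id`, `V = x²` (`m = L = 2`): `‖b − a‖ ≤ √1·‖b − a‖` — §2 is TIGHT.

NOT HERE (honest): existence of the (window) minimisers (CVD §6 ∕ CVW ∕ CSTF on a proper `E`); that Bałaban's small-field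
actions carry these letters ((A3) ∕ (A1c), NC-NE7b-α UNRULED); nonlinear constraints (CMRN's setting); gauge ORBITS (N-93-3:
pose on a gauge-fixed section); optimality of `√(L∕m)` for the defect (for quadratic `V` the true ratio is `(κ−1)∕(2√κ)`,
`κ = L∕m`).  BY-NAME EFFECT ON THE WALL: NONE.  NE7b NOT PRINTED ∕ NOT PROVED; spine PROVED 0∕9; rung (B)+1 on a FINITE
torus — NOT infinite volume, NOT the mass gap, NOT Clay.  HONEST DEPENDENCY: continuum YM on T⁴ ⇐ BetaPertH ∧ nine spine
estimates (0/9 proved); BetaPertH ⇐ (D1) ∧ (D4) ∧ CAP+tail; G-an2-4 gates asym, D1 and NE2∕3∕4.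
-/

set_option autoImplicit false

namespace Summit.QuantumFields.BalabanUV.T4Continuum.NE7b.HardStepBackgroundLipschitz

variable {E F : Type*} [NormedAddCommGroup E] [NormedSpace ℝ E] [NormedAddCommGroup F] [NormedSpace ℝ F]

/-! ## §1. The three-letter chain -/

/-- **`m(‖a + Mh − b‖² + ‖a − b‖²) ≤ L‖Mh‖²`** (`h = D b − D a`): the LOWER letter at `b` tested at `a`, the LOWER letter
at `a` tested at the competitor `b − Mh` (on `a`'s fibre), the GROWTH letter at `b` tested at `−Mh`; the linear terms die
because `A` and `B` kill the defect `a + Mh − b ∈ ker D`.  Letters asked on `K` only; test points `a`, `b − Mh ∈ K`.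
[folklore] -/
theorem sq_defect_add_sq_sub_le {K : Set E} {V : E → ℝ} {D : E →L[ℝ] F} {M : F →L[ℝ] E} (hM : ∀ w, D (M w) = w)
    {a b : E} {A B : E →L[ℝ] ℝ} {L m : ℝ} (hAker : ∀ k, D k = 0 → A k = 0) (hBker : ∀ k, D k = 0 → B k = 0)
    (hlowa : ∀ x ∈ K, V a + A (x - a) + m / 2 * ‖x - a‖ ^ 2 ≤ V x)
    (hlowb : ∀ x ∈ K, V b + B (x - b) + m / 2 * ‖x - b‖ ^ 2 ≤ V x)
    (hgrowb : ∀ v, b + v ∈ K → V (b + v) ≤ V b + B v + L / 2 * ‖v‖ ^ 2)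
    (ha : a ∈ K) (hbM : b - M (D b - D a) ∈ K) :
    m * (‖a + M (D b - D a) - b‖ ^ 2 + ‖a - b‖ ^ 2) ≤ L * ‖M (D b - D a)‖ ^ 2 := by
  set h := D b - D a with hh
  have hΔker : D (a + M h - b) = 0 := by
    rw [map_sub, map_add, hM, hh]; abel
  have hAΔ : A (a + M h - b) = 0 := hAker _ hΔker
  have hBΔ : B (a + M h - b) = 0 := hBker _ hΔker
  -- (1) the lower letter at `b` tested at `a`
  have h1 := hlowb a ha
  have hB1 : B (a - b) = -B (M h) := by
    rw [show a - b = (a + M h - b) - M h by abel, map_sub, hBΔ, zero_sub]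
  rw [hB1] at h1
  -- (2) the lower letter at `a` tested at the competitor `b − Mh`
  have h2 := hlowa (b - M h) hbM
  have e2 : b - M h - a = -(a + M h - b) := by abel
  rw [e2, map_neg, hAΔ, neg_zero, add_zero, norm_neg] at h2
  -- (3) the growth letter at `b` tested at `−Mh`
  have h3 := hgrowb (-(M h)) (by rw [← sub_eq_add_neg]; exact hbM)
  rw [← sub_eq_add_neg, map_neg, norm_neg] at h3
  linarith [h1, h2, h3]

/-! ## §2. The background field is Lipschitz in the kept variable -/

/-- `‖b − a‖² ≤ (L∕m)‖Mh‖²` (`0 < m`) from §1. [folklore] -/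
theorem sq_norm_sub_le_of_letters {K : Set E} {V : E → ℝ} {D : E →L[ℝ] F} {M : F →L[ℝ] E} (hM : ∀ w, D (M w) = w)
    {a b : E} {A B : E →L[ℝ] ℝ} {L m : ℝ} (hm : 0 < m) (hAker : ∀ k, D k = 0 → A k = 0)
    (hBker : ∀ k, D k = 0 → B k = 0) (hlowa : ∀ x ∈ K, V a + A (x - a) + m / 2 * ‖x - a‖ ^ 2 ≤ V x)
    (hlowb : ∀ x ∈ K, V b + B (x - b) + m / 2 * ‖x - b‖ ^ 2 ≤ V x)
    (hgrowb : ∀ v, b + v ∈ K → V (b + v) ≤ V b + B v + L / 2 * ‖v‖ ^ 2)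
    (ha : a ∈ K) (hbM : b - M (D b - D a) ∈ K) :
    ‖b - a‖ ^ 2 ≤ L / m * ‖M (D b - D a)‖ ^ 2 := by
  have h := sq_defect_add_sq_sub_le hM hAker hBker hlowa hlowb hgrowb ha hbM
  rw [norm_sub_rev b a, div_mul_eq_mul_div, le_div_iff₀ hm]
  nlinarith [h, mul_nonneg hm.le (sq_nonneg ‖a + M (D b - D a) - b‖)]

/-- **THE BACKGROUND FIELD OF THE HARD STEP IS LIPSCHITZ IN THE KEPT VARIABLE**: `‖b − a‖ ≤ √(L∕m)·‖M (D b − D a)‖`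
(`0 < m`) — the two fibre minimisers differ by at most `√(L∕m)` times `M` applied to the difference of the constraint
values, from the letters ON `K` at the test points `a`, `b − Mh ∈ K`. [folklore] -/
theorem norm_sub_le_of_letters {K : Set E} {V : E → ℝ} {D : E →L[ℝ] F} {M : F →L[ℝ] E} (hM : ∀ w, D (M w) = w)
    {a b : E} {A B : E →L[ℝ] ℝ} {L m : ℝ} (hm : 0 < m) (hAker : ∀ k, D k = 0 → A k = 0)
    (hBker : ∀ k, D k = 0 → B k = 0) (hlowa : ∀ x ∈ K, V a + A (x - a) + m / 2 * ‖x - a‖ ^ 2 ≤ V x)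
    (hlowb : ∀ x ∈ K, V b + B (x - b) + m / 2 * ‖x - b‖ ^ 2 ≤ V x)
    (hgrowb : ∀ v, b + v ∈ K → V (b + v) ≤ V b + B v + L / 2 * ‖v‖ ^ 2)
    (ha : a ∈ K) (hbM : b - M (D b - D a) ∈ K) :
    ‖b - a‖ ≤ Real.sqrt (L / m) * ‖M (D b - D a)‖ := by
  have h := sq_norm_sub_le_of_letters hM hm hAker hBker hlowa hlowb hgrowb ha hbM
  calc ‖b - a‖ = Real.sqrt (‖b - a‖ ^ 2) := (Real.sqrt_sq (norm_nonneg _)).symm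
    _ ≤ Real.sqrt (L / m * ‖M (D b - D a)‖ ^ 2) := Real.sqrt_le_sqrt h
    _ = Real.sqrt (L / m) * ‖M (D b - D a)‖ := by
      rw [Real.sqrt_mul' _ (sq_nonneg _), Real.sqrt_sq (norm_nonneg _)]

/-- The DEFECT bound: `‖a + Mh − b‖ ≤ √(L∕m)·‖Mh‖` (`h = D b − D a`, `0 < m`), same letters and test points. [folklore] -/
theorem norm_defect_le {K : Set E} {V : E → ℝ} {D : E →L[ℝ] F} {M : F →L[ℝ] E} (hM : ∀ w, D (M w) = w)
    {a b : E} {A B : E →L[ℝ] ℝ} {L m : ℝ} (hm : 0 < m) (hAker : ∀ k, D k = 0 → A k = 0)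
    (hBker : ∀ k, D k = 0 → B k = 0) (hlowa : ∀ x ∈ K, V a + A (x - a) + m / 2 * ‖x - a‖ ^ 2 ≤ V x)
    (hlowb : ∀ x ∈ K, V b + B (x - b) + m / 2 * ‖x - b‖ ^ 2 ≤ V x)
    (hgrowb : ∀ v, b + v ∈ K → V (b + v) ≤ V b + B v + L / 2 * ‖v‖ ^ 2)
    (ha : a ∈ K) (hbM : b - M (D b - D a) ∈ K) :
    ‖a + M (D b - D a) - b‖ ≤ Real.sqrt (L / m) * ‖M (D b - D a)‖ := by
  have h := sq_defect_add_sq_sub_le hM hAker hBker hlowa hlowb hgrowb ha hbM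
  have h2 : ‖a + M (D b - D a) - b‖ ^ 2 ≤ L / m * ‖M (D b - D a)‖ ^ 2 := by
    rw [div_mul_eq_mul_div, le_div_iff₀ hm]
    nlinarith [h, mul_nonneg hm.le (sq_nonneg ‖a - b‖)]
  calc ‖a + M (D b - D a) - b‖ = Real.sqrt (‖a + M (D b - D a) - b‖ ^ 2) := (Real.sqrt_sq (norm_nonneg _)).symm
    _ ≤ Real.sqrt (L / m * ‖M (D b - D a)‖ ^ 2) := Real.sqrt_le_sqrt h2
    _ = Real.sqrt (L / m) * ‖M (D b - D a)‖ := by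
      rw [Real.sqrt_mul' _ (sq_nonneg _), Real.sqrt_sq (norm_nonneg _)]

/-- … hence with the operator norm: `‖b − a‖ ≤ √(L∕m)·‖M‖·‖D b − D a‖`. [folklore] -/
theorem norm_sub_le_opNorm_of_letters {K : Set E} {V : E → ℝ} {D : E →L[ℝ] F} {M : F →L[ℝ] E}
    (hM : ∀ w, D (M w) = w) {a b : E} {A B : E →L[ℝ] ℝ} {L m : ℝ} (hm : 0 < m) (hAker : ∀ k, D k = 0 → A k = 0)
    (hBker : ∀ k, D k = 0 → B k = 0) (hlowa : ∀ x ∈ K, V a + A (x - a) + m / 2 * ‖x - a‖ ^ 2 ≤ V x)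
    (hlowb : ∀ x ∈ K, V b + B (x - b) + m / 2 * ‖x - b‖ ^ 2 ≤ V x)
    (hgrowb : ∀ v, b + v ∈ K → V (b + v) ≤ V b + B v + L / 2 * ‖v‖ ^ 2)
    (ha : a ∈ K) (hbM : b - M (D b - D a) ∈ K) :
    ‖b - a‖ ≤ Real.sqrt (L / m) * ‖M‖ * ‖D b - D a‖ := by
  have h := norm_sub_le_of_letters hM hm hAker hBker hlowa hlowb hgrowb ha hbM
  have hC : 0 ≤ Real.sqrt (L / m) := Real.sqrt_nonneg _
  calc ‖b - a‖ ≤ Real.sqrt (L / m) * ‖M (D b - D a)‖ := h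
    _ ≤ Real.sqrt (L / m) * (‖M‖ * ‖D b - D a‖) := mul_le_mul_of_nonneg_left (M.le_opNorm _) hC
    _ = Real.sqrt (L / m) * ‖M‖ * ‖D b - D a‖ := by ring

/-- **SMALL STEPS INSIDE A BALL**: with the letters on `K = closedBall c R`, the two memberships read `‖a − c‖ ≤ R` and
`‖b − c‖ + ‖Mh‖ ≤ R` (`h = D b − D a`), and `‖b − a‖ ≤ √(L∕m)·‖Mh‖`. [folklore] -/
theorem norm_sub_le_of_letters_closedBall {V : E → ℝ} {D : E →L[ℝ] F} {M : F →L[ℝ] E} (hM : ∀ w, D (M w) = w)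
    {c a b : E} {R : ℝ} {A B : E →L[ℝ] ℝ} {L m : ℝ} (hm : 0 < m) (hAker : ∀ k, D k = 0 → A k = 0)
    (hBker : ∀ k, D k = 0 → B k = 0)
    (hlowa : ∀ x ∈ Metric.closedBall c R, V a + A (x - a) + m / 2 * ‖x - a‖ ^ 2 ≤ V x)
    (hlowb : ∀ x ∈ Metric.closedBall c R, V b + B (x - b) + m / 2 * ‖x - b‖ ^ 2 ≤ V x)
    (hgrowb : ∀ v, b + v ∈ Metric.closedBall c R → V (b + v) ≤ V b + B v + L / 2 * ‖v‖ ^ 2)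
    (haR : ‖a - c‖ ≤ R) (hbR : ‖b - c‖ + ‖M (D b - D a)‖ ≤ R) :
    ‖b - a‖ ≤ Real.sqrt (L / m) * ‖M (D b - D a)‖ := by
  have ha : a ∈ Metric.closedBall c R := by rwa [Metric.mem_closedBall, dist_eq_norm]
  have hbM : b - M (D b - D a) ∈ Metric.closedBall c R := by
    rw [Metric.mem_closedBall, dist_eq_norm]
    calc ‖b - M (D b - D a) - c‖ = ‖(b - c) - M (D b - D a)‖ := by congr 1; abel
      _ ≤ ‖b - c‖ + ‖M (D b - D a)‖ := norm_sub_le _ _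
      _ ≤ R := hbR
  exact norm_sub_le_of_letters hM hm hAker hBker hlowa hlowb hgrowb ha hbM

/-! ## §3. The differentials (the multiplier) are Lipschitz in the kept variable -/

/-- **`(A − B) v ≤ (L∕2)(‖a − b‖² + ‖v‖²)`** from the GROWTH letters at `a` and at `b` (constant `L`) and the convex LOWER
letter at `b` (any modulus `m ≥ 0`, dropped), ON `K`: the growth letter at `a` and the lower letter at `b` are tested at
`a − v ∈ K`, the growth letter at `b` at `a ∈ K`. [folklore] -/
theorem sub_apply_le_of_letters {K : Set E} {V : E → ℝ} {a b : E} {A B : E →L[ℝ] ℝ} {L m : ℝ} (hm : 0 ≤ m)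
    (hgrowa : ∀ v, a + v ∈ K → V (a + v) ≤ V a + A v + L / 2 * ‖v‖ ^ 2)
    (hlowb : ∀ x ∈ K, V b + B (x - b) + m / 2 * ‖x - b‖ ^ 2 ≤ V x)
    (hgrowb : ∀ v, b + v ∈ K → V (b + v) ≤ V b + B v + L / 2 * ‖v‖ ^ 2) (ha : a ∈ K) {v : E}
    (hv : a - v ∈ K) : (A - B) v ≤ L / 2 * (‖a - b‖ ^ 2 + ‖v‖ ^ 2) := by
  rw [sub_eq_add_neg] at hv
  have h1 := hgrowa (-v) hv
  have h2 := hlowb (a + -v) hv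
  have h4 := hgrowb (a - b) (by rw [show b + (a - b) = a by abel]; exact ha)
  rw [show b + (a - b) = a by abel] at h4
  have hBsplit : B (a + -v - b) = B (a - b) - B v := by
    rw [show a + -v - b = (a - b) - v by abel, map_sub]
  rw [map_neg, norm_neg] at h1
  have hm1 : 0 ≤ m / 2 * ‖a + -v - b‖ ^ 2 := by positivity
  rw [sub_apply]
  linarith [h1, h2, h4, hBsplit, hm1]

/-- Scaled, multiplicative form ON `K`: `t·(A − B) v ≤ (L∕2)(‖a − b‖² + t²‖v‖²)` provided `a ∈ K` and `a − t•v ∈ K`.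
[folklore] -/
theorem mul_sub_apply_le_of_letters {K : Set E} {V : E → ℝ} {a b : E} {A B : E →L[ℝ] ℝ} {L m : ℝ} (hm : 0 ≤ m)
    (hgrowa : ∀ v, a + v ∈ K → V (a + v) ≤ V a + A v + L / 2 * ‖v‖ ^ 2)
    (hlowb : ∀ x ∈ K, V b + B (x - b) + m / 2 * ‖x - b‖ ^ 2 ≤ V x)
    (hgrowb : ∀ v, b + v ∈ K → V (b + v) ≤ V b + B v + L / 2 * ‖v‖ ^ 2) (ha : a ∈ K) {v : E} {t : ℝ}
    (hv : a - t • v ∈ K) : t * (A - B) v ≤ L / 2 * (‖a - b‖ ^ 2 + t ^ 2 * ‖v‖ ^ 2) := by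
  have h := sub_apply_le_of_letters hm hgrowa hlowb hgrowb ha hv
  rw [map_smul, smul_eq_mul, norm_smul, mul_pow, Real.norm_eq_abs, sq_abs] at h
  exact h

/-- **`|(A − B) v| ≤ L·ρ·‖v‖`** as soon as the window holds the ball `closedBall a ρ` with `‖a − b‖ ≤ ρ`, `0 < ρ`
(`0 ≤ L`): the multiplicative form at `t = ±ρ∕‖v‖`. [folklore] -/
theorem abs_sub_apply_le_of_letters_ball {K : Set E} {V : E → ℝ} {a b : E} {A B : E →L[ℝ] ℝ} {L m : ℝ}
    (hm : 0 ≤ m) (hL : 0 ≤ L) (hgrowa : ∀ v, a + v ∈ K → V (a + v) ≤ V a + A v + L / 2 * ‖v‖ ^ 2)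
    (hlowb : ∀ x ∈ K, V b + B (x - b) + m / 2 * ‖x - b‖ ^ 2 ≤ V x)
    (hgrowb : ∀ v, b + v ∈ K → V (b + v) ≤ V b + B v + L / 2 * ‖v‖ ^ 2) {ρ : ℝ} (hρ : 0 < ρ)
    (hK : Metric.closedBall a ρ ⊆ K) (hab : ‖a - b‖ ≤ ρ) (v : E) : |(A - B) v| ≤ L * ρ * ‖v‖ := by
  have ha : a ∈ K := hK (Metric.mem_closedBall_self hρ.le)
  by_cases hv0 : v = 0
  · simp [hv0]
  · have hvn : 0 < ‖v‖ := norm_pos_iff.mpr hv0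
    obtain ⟨t, ht0, htv⟩ : ∃ t : ℝ, 0 < t ∧ t * ‖v‖ = ρ := ⟨ρ / ‖v‖, by positivity, by field_simp⟩
    have hmem : ∀ s : ℝ, |s| = t → a - s • v ∈ K := by
      intro s hs
      apply hK
      rw [Metric.mem_closedBall, dist_eq_norm, show a - s • v - a = -(s • v) by abel, norm_neg, norm_smul,
        Real.norm_eq_abs, hs, htv]
    have hplus := mul_sub_apply_le_of_letters hm hgrowa hlowb hgrowb ha (hmem t (abs_of_pos ht0))
    have hminus := mul_sub_apply_le_of_letters hm hgrowa hlowb hgrowb ha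
      (hmem (-t) (by rw [abs_neg, abs_of_pos ht0]))
    rw [neg_sq, neg_mul, ← mul_neg] at hminus
    have hR2 : ‖a - b‖ ^ 2 ≤ ρ ^ 2 := pow_le_pow_left₀ (norm_nonneg _) hab 2
    have key : L / 2 * (‖a - b‖ ^ 2 + t ^ 2 * ‖v‖ ^ 2) ≤ t * (L * ρ * ‖v‖) := by
      have e1 : t ^ 2 * ‖v‖ ^ 2 = ρ ^ 2 := by rw [← mul_pow, htv]
      have e2 : t * (L * ρ * ‖v‖) = L * ρ ^ 2 := by
        rw [show t * (L * ρ * ‖v‖) = L * ρ * (t * ‖v‖) by ring, htv]; ring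
      rw [e1, e2]
      nlinarith [mul_le_mul_of_nonneg_left hR2 hL]
    have hX : (A - B) v ≤ L * ρ * ‖v‖ := le_of_mul_le_mul_left (hplus.trans key) ht0
    have hX' : -(A - B) v ≤ L * ρ * ‖v‖ := le_of_mul_le_mul_left (hminus.trans key) ht0
    exact abs_le.mpr ⟨by linarith, hX⟩

/-- `‖A − B‖ ≤ L·ρ` under the hypotheses of `abs_sub_apply_le_of_letters_ball`. [folklore] -/
theorem opNorm_sub_le_of_letters_ball {K : Set E} {V : E → ℝ} {a b : E} {A B : E →L[ℝ] ℝ} {L m : ℝ}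
    (hm : 0 ≤ m) (hL : 0 ≤ L) (hgrowa : ∀ v, a + v ∈ K → V (a + v) ≤ V a + A v + L / 2 * ‖v‖ ^ 2)
    (hlowb : ∀ x ∈ K, V b + B (x - b) + m / 2 * ‖x - b‖ ^ 2 ≤ V x)
    (hgrowb : ∀ v, b + v ∈ K → V (b + v) ≤ V b + B v + L / 2 * ‖v‖ ^ 2) {ρ : ℝ} (hρ : 0 < ρ)
    (hK : Metric.closedBall a ρ ⊆ K) (hab : ‖a - b‖ ≤ ρ) : ‖A - B‖ ≤ L * ρ :=
  ContinuousLinearMap.opNorm_le_bound _ (by positivity) fun v => by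
    rw [Real.norm_eq_abs]
    exact abs_sub_apply_le_of_letters_ball hm hL hgrowa hlowb hgrowb hρ hK hab v

/-- GLOBAL letters: **`‖A − B‖ ≤ L‖a − b‖`** — the differentials at the two minimisers (for the hard step, the
multipliers `λ ∘ D`) are `L`-Lipschitz in the point, from the growth letters at both points and convexity at `b`.
[folklore] -/
theorem opNorm_sub_le_of_letters {V : E → ℝ} {a b : E} {A B : E →L[ℝ] ℝ} {L m : ℝ} (hm : 0 ≤ m) (hL : 0 ≤ L)
    (hgrowa : ∀ v, V (a + v) ≤ V a + A v + L / 2 * ‖v‖ ^ 2)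
    (hlowb : ∀ x, V b + B (x - b) + m / 2 * ‖x - b‖ ^ 2 ≤ V x)
    (hgrowb : ∀ v, V (b + v) ≤ V b + B v + L / 2 * ‖v‖ ^ 2) : ‖A - B‖ ≤ L * ‖a - b‖ := by
  refine le_of_forall_pos_le_add fun ε hε => ?_
  have hL1 : 0 < L + 1 := by linarith
  have hρ : 0 < ‖a - b‖ + ε / (L + 1) := by positivity
  have h := opNorm_sub_le_of_letters_ball (K := Set.univ) hm hL (fun v _ => hgrowa v) (fun x _ => hlowb x)
    (fun v _ => hgrowb v) hρ (Set.subset_univ _) (by linarith [div_pos hε hL1])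
  have hfrac : L * (ε / (L + 1)) ≤ ε := by
    rw [mul_div_assoc', div_le_iff₀ hL1]; nlinarith
  calc ‖A - B‖ ≤ L * (‖a - b‖ + ε / (L + 1)) := h
    _ = L * ‖a - b‖ + L * (ε / (L + 1)) := by ring
    _ ≤ L * ‖a - b‖ + ε := by linarith

/-- GLOBAL letters: **THE MULTIPLIER OF THE HARD STEP IS LIPSCHITZ IN THE KEPT VARIABLE** —
`‖A − B‖ ≤ L·√(L∕m)·‖M (D b − D a)‖` for any right inverse `M` of `D` (§3 with §2). [folklore] -/
theorem opNorm_sub_le_of_rightInverse {V : E → ℝ} {D : E →L[ℝ] F} {M : F →L[ℝ] E} (hM : ∀ w, D (M w) = w)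
    {a b : E} {A B : E →L[ℝ] ℝ} {L m : ℝ} (hm : 0 < m) (hL : 0 ≤ L) (hAker : ∀ k, D k = 0 → A k = 0)
    (hBker : ∀ k, D k = 0 → B k = 0) (hlowa : ∀ x, V a + A (x - a) + m / 2 * ‖x - a‖ ^ 2 ≤ V x)
    (hgrowa : ∀ v, V (a + v) ≤ V a + A v + L / 2 * ‖v‖ ^ 2)
    (hlowb : ∀ x, V b + B (x - b) + m / 2 * ‖x - b‖ ^ 2 ≤ V x)
    (hgrowb : ∀ v, V (b + v) ≤ V b + B v + L / 2 * ‖v‖ ^ 2) :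
    ‖A - B‖ ≤ L * (Real.sqrt (L / m) * ‖M (D b - D a)‖) := by
  have h1 := opNorm_sub_le_of_letters hm.le hL hgrowa hlowb hgrowb
  have h2 := norm_sub_le_of_letters (K := Set.univ) hM hm hAker hBker (fun x _ => hlowa x) (fun x _ => hlowb x)
    (fun v _ => hgrowb v) (Set.mem_univ _) (Set.mem_univ _)
  rw [norm_sub_rev] at h2
  exact h1.trans (mul_le_mul_of_nonneg_left h2 hL)

/-! ## §4. Toy -/

/-- Toy: `E = F = ℝ`, `K = univ`, `D = M = id`, `V x = x²` (`A = 2a·`, `B = 2b·`, `m = L = 2`): every point is its own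
fibre minimiser and §2 returns `‖b − a‖ ≤ √(2∕2)·‖b − a‖` — tight. [folklore] -/
example (a b : ℝ) : ‖b - a‖ ≤ Real.sqrt (2 / 2) * ‖(ContinuousLinearMap.id ℝ ℝ) ((ContinuousLinearMap.id ℝ ℝ) b
    - (ContinuousLinearMap.id ℝ ℝ) a)‖ := by
  refine norm_sub_le_of_letters (K := Set.univ) (V := fun x : ℝ => x ^ 2) (A := (2 * a) • ContinuousLinearMap.id ℝ ℝ)
    (B := (2 * b) • ContinuousLinearMap.id ℝ ℝ) (L := 2) (fun w => rfl) two_pos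
    (fun k hk => by simp [show k = 0 from hk]) (fun k hk => by simp [show k = 0 from hk]) ?_ ?_ ?_
    (Set.mem_univ _) (Set.mem_univ _)
  all_goals intro x _; simp only [smul_apply, ContinuousLinearMap.coe_id', id_eq,
    smul_eq_mul, Real.norm_eq_abs, sq_abs]; nlinarith [sq_nonneg (x - a), sq_nonneg (x - b), sq_nonneg x]

end Summit.QuantumFields.BalabanUV.T4Continuum.NE7b.HardStepBackgroundLipschitz
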